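import Literature.Probability.LatticeModels.GaussianLinearImage
import Mathlib.LinearAlgebra.FiniteDimensional.Basic
import HarnessLib

/-!
# The infrared-regularised Coulomb form `q ↦ ⟨q, (DDᵀ + ε)⁻¹ q⟩` and its `ε → 0` limit on fluxes

Support file for the Coulomb-gas (monopole) representation of four-dimensional `U(1)` lattice gauge
theory with the Villain action (proof programme of the named fact
`Literature.MathematicalPhysics.QuantumFieldTheory.FrohlichSpencerU1PerimeterLawD4` and of its
corollary `Literature.Barriers.QuantumFields.AbelianDeconfinementD4`). Fröhlich–Spencer regularise
the Gaussian measure of the dual model by an infrared mass `ε > 0` ((2.32): covariance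
`V_{Λ,ε} = (Π_Λ(δd + ε))⁻¹`) and pass to `ε → 0` ((2.34): the quadratic form tends to
`(μ, V_Λ μ)` on co-closed `μ` and to `+∞` otherwise, so that only closed charge densities survive,
(2.43)–(2.44)). In the tree's primal matrix language — `D` the real flux map (plaquette fields of
the cube → cube fields), `T = dMat` the coboundary from free link angles with `ker D = range T`
(`VillainFluxReal.ker_fluxMapR_eq_range_dFreeR`) — this file proves the finite-dimensional facts,
all by completing squares (no spectral theory, no pseudo-inverse):

* `dotProduct_inv_mulVec_eq_of_posDef` / `two_mul_dotProduct_sub_le` (**variational formula**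
  `⟨q, M⁻¹q⟩ = max_a (2⟨a,q⟩ - ⟨a,Ma⟩)` for positive definite `M`), whence
  `dotProduct_inv_mulVec_le_div` (`⟨x,(G+ε)⁻¹x⟩ ≤ ‖x‖²/ε` for `G ⪰ 0`) and monotonicity in `ε`;
* `regForm D ε q = ⟨q, (DDᵀ + ε)⁻¹ q⟩`, the push-through identity and
  `regForm_flux_eq : regForm D ε (Dm) = ‖m‖² - ε ⟨m, (DᵀD + ε)⁻¹ m⟩`;
* with `ker D = range T`: `regForm_flux_le` / `regForm_flux_ge`
  (**`‖m_⊥‖² - Kε ≤ regForm D ε (Dm) ≤ ‖m_⊥‖²`**, `m_⊥ = perpPart T m`; the key step writes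
  `m_⊥ = DᵀD w₀` with `Tᵀw₀ = 0`, by injectivity-hence-surjectivity of `DᵀD` on `{Tᵀ· = 0}`);
* `regForm_ge_sq_div` (**divergence off the fluxes**: `Dᵀa₀ = 0 ⇒ regForm D ε q ≥ ⟨a₀,q⟩²/(ε‖a₀‖²)`);
* `regForm_ge_norm_sq_div` (**uniform coercivity**: `‖Dᵀq‖² ≤ L‖q‖² ⇒ regForm D ε q ≥ ‖q‖²/(L+ε)`,
  the summable domination for `ε ≤ 1`).

Everything is proved; no named fact is introduced.

## References

* J. Fröhlich, T. Spencer, Comm. Math. Phys. 83 (1982) 411–454, §2.5 (2.32)–(2.35), §2.6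
  (2.43)–(2.44). [FrohlichSpencerCMP1982]
-/

noncomputable section

open Matrix Finset

namespace Literature.Probability.LatticeModels

namespace GaussianCoord

variable {ι κ P : Type*} [Fintype ι] [Fintype κ] [Fintype P] [DecidableEq ι] [DecidableEq κ] [DecidableEq P]

/-! ### The variational formula for positive definite matrices -/

omit [Fintype κ] [DecidableEq κ] in
/-- A real positive definite matrix is symmetric. [folklore] -/
theorem transpose_eq_of_posDef {M : Matrix κ κ ℝ} (hM : M.PosDef) : Mᵀ = M := by
  have h := hM.isHermitian
  rwa [Matrix.IsHermitian, Matrix.conjTranspose_eq_transpose_of_trivial] at h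

omit [DecidableEq κ] in
/-- For symmetric `M`: `⟨a, M b⟩ = ⟨b, M a⟩`. [folklore] -/
theorem dotProduct_mulVec_comm_of_transpose_eq {M : Matrix κ κ ℝ} (hM : Mᵀ = M) (a b : κ → ℝ) :
    a ⬝ᵥ (M *ᵥ b) = b ⬝ᵥ (M *ᵥ a) := by
  rw [dotProduct_mulVec, ← Matrix.mulVec_transpose, hM, dotProduct_comm]

/-- **Completing the square**: for positive definite `M` and all `a`,
`2⟨a, q⟩ - ⟨a, Ma⟩ = ⟨q, M⁻¹q⟩ - ⟨a - M⁻¹q, M(a - M⁻¹q)⟩`. [folklore] -/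
theorem two_mul_dotProduct_sub_eq {M : Matrix κ κ ℝ} (hM : M.PosDef) (q a : κ → ℝ) :
    2 * (a ⬝ᵥ q) - a ⬝ᵥ (M *ᵥ a) =
      q ⬝ᵥ (M⁻¹ *ᵥ q) - (a - M⁻¹ *ᵥ q) ⬝ᵥ (M *ᵥ (a - M⁻¹ *ᵥ q)) := by
  have hdet : IsUnit M.det := (Matrix.isUnit_iff_isUnit_det _).1 hM.isUnit
  have hsymm := transpose_eq_of_posDef hM
  set b := M⁻¹ *ᵥ q with hb
  have hq : M *ᵥ b = q := by rw [hb, Matrix.mulVec_mulVec, Matrix.mul_nonsing_inv _ hdet, Matrix.one_mulVec]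
  rw [← hq, Matrix.mulVec_sub, sub_dotProduct, dotProduct_sub, dotProduct_sub,
    dotProduct_mulVec_comm_of_transpose_eq hsymm b a, dotProduct_comm (M *ᵥ b) b]
  ring

/-- **The variational inequality**: `2⟨a, q⟩ - ⟨a, Ma⟩ ≤ ⟨q, M⁻¹q⟩` for positive definite `M`.
[cite: FrohlichSpencerCMP1982, §2.5 (2.33) (the Gaussian covariance as a maximum)] -/
theorem two_mul_dotProduct_sub_le {M : Matrix κ κ ℝ} (hM : M.PosDef) (q a : κ → ℝ) :
    2 * (a ⬝ᵥ q) - a ⬝ᵥ (M *ᵥ a) ≤ q ⬝ᵥ (M⁻¹ *ᵥ q) := by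
  rw [two_mul_dotProduct_sub_eq hM q a, sub_le_self_iff]
  simpa using hM.posSemidef.dotProduct_mulVec_nonneg (a - M⁻¹ *ᵥ q)

/-- The maximum is attained at `a = M⁻¹q`: `⟨q, M⁻¹q⟩ = 2⟨M⁻¹q, q⟩ - ⟨M⁻¹q, M M⁻¹q⟩`. [folklore] -/
theorem dotProduct_inv_mulVec_eq_of_posDef {M : Matrix κ κ ℝ} (hM : M.PosDef) (q : κ → ℝ) :
    q ⬝ᵥ (M⁻¹ *ᵥ q) = 2 * ((M⁻¹ *ᵥ q) ⬝ᵥ q) - (M⁻¹ *ᵥ q) ⬝ᵥ (M *ᵥ (M⁻¹ *ᵥ q)) := by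
  rw [two_mul_dotProduct_sub_eq hM q]
  simp

/-- `⟨q, M⁻¹q⟩ ≥ 0` for positive definite `M`. [folklore] -/
theorem dotProduct_inv_mulVec_nonneg {M : Matrix κ κ ℝ} (hM : M.PosDef) (q : κ → ℝ) :
    0 ≤ q ⬝ᵥ (M⁻¹ *ᵥ q) := by
  have h := two_mul_dotProduct_sub_le hM q 0
  simpa using h

/-- **Monotonicity**: if `⟨a, M a⟩ ≤ ⟨a, N a⟩` for all `a` (both positive definite) then
`⟨q, N⁻¹q⟩ ≤ ⟨q, M⁻¹q⟩`. [folklore] -/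
theorem dotProduct_inv_mulVec_anti {M N : Matrix κ κ ℝ} (hM : M.PosDef) (hN : N.PosDef)
    (hle : ∀ a, a ⬝ᵥ (M *ᵥ a) ≤ a ⬝ᵥ (N *ᵥ a)) (q : κ → ℝ) :
    q ⬝ᵥ (N⁻¹ *ᵥ q) ≤ q ⬝ᵥ (M⁻¹ *ᵥ q) := by
  rw [dotProduct_inv_mulVec_eq_of_posDef hN q]
  exact (sub_le_sub_left (hle _) _).trans (two_mul_dotProduct_sub_le hM q _)

/-- **`⟨x, (G + ε)⁻¹ x⟩ ≤ ‖x‖²/ε`** for `G ⪰ 0` and `ε > 0`. [folklore] -/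
theorem dotProduct_inv_mulVec_le_div {G : Matrix κ κ ℝ} (hG : G.PosSemidef) {ε : ℝ} (hε : 0 < ε)
    (x : κ → ℝ) : x ⬝ᵥ ((G + ε • (1 : Matrix κ κ ℝ))⁻¹ *ᵥ x) ≤ (x ⬝ᵥ x) / ε := by
  have hP : (G + ε • (1 : Matrix κ κ ℝ)).PosDef := PosDef.posSemidef_add hG (PosDef.one.smul hε)
  rw [dotProduct_inv_mulVec_eq_of_posDef hP x]
  set a := (G + ε • (1 : Matrix κ κ ℝ))⁻¹ *ᵥ x
  have hGa : 0 ≤ a ⬝ᵥ (G *ᵥ a) := by simpa using hG.dotProduct_mulVec_nonneg a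
  rw [Matrix.add_mulVec, Matrix.smul_mulVec, Matrix.one_mulVec, dotProduct_add, dotProduct_smul, smul_eq_mul]
  -- `2⟨a,x⟩ - ⟨a,Ga⟩ - ε‖a‖² ≤ 2⟨a,x⟩ - ε‖a‖² ≤ ‖x‖²/ε`
  have key : 2 * (a ⬝ᵥ x) - ε * (a ⬝ᵥ a) ≤ (x ⬝ᵥ x) / ε := by
    rw [le_div_iff₀ hε]
    have : 0 ≤ (ε • a - x) ⬝ᵥ (ε • a - x) := by
      simpa [dotProduct] using Finset.sum_nonneg fun i _ => mul_self_nonneg ((ε • a - x) i)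
    rw [sub_dotProduct, dotProduct_sub, dotProduct_sub, smul_dotProduct, dotProduct_smul, dotProduct_smul,
      smul_dotProduct, smul_eq_mul, smul_eq_mul, smul_eq_mul, smul_eq_mul, dotProduct_comm x a] at this
    nlinarith
  linarith

/-! ### The regularised Coulomb form of a flux map -/

/-- **The regularised Coulomb form** `Φ_ε(q) = ⟨q, (DDᵀ + ε)⁻¹ q⟩` of the flux map `D`
(FS82 (2.32)–(2.33): the covariance of the infrared-regularised dual Gaussian, on charge
densities). [cite: FrohlichSpencerCMP1982, §2.5 (2.32)–(2.33)] -/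
def regForm (D : Matrix κ P ℝ) (ε : ℝ) (q : κ → ℝ) : ℝ :=
  q ⬝ᵥ (((D * Dᵀ : Matrix κ κ ℝ) + ε • (1 : Matrix κ κ ℝ))⁻¹ *ᵥ q)

omit [DecidableEq P] in
/-- `DDᵀ + ε` is positive definite for `ε > 0`. [folklore] -/
theorem posDef_mul_transpose_add (D : Matrix κ P ℝ) {ε : ℝ} (hε : 0 < ε) :
    ((D * Dᵀ : Matrix κ κ ℝ) + ε • (1 : Matrix κ κ ℝ)).PosDef := by
  have h : (D * Dᵀ : Matrix κ κ ℝ).PosSemidef := by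
    simpa [Matrix.conjTranspose_eq_transpose_of_trivial] using Matrix.posSemidef_self_mul_conjTranspose D
  exact PosDef.posSemidef_add h (PosDef.one.smul hε)

omit [DecidableEq κ] in
/-- `DᵀD + ε` is positive definite for `ε > 0`. [folklore] -/
theorem posDef_transpose_mul_add (D : Matrix κ P ℝ) {ε : ℝ} (hε : 0 < ε) :
    ((Dᵀ * D : Matrix P P ℝ) + ε • (1 : Matrix P P ℝ)).PosDef := by
  have h : (Dᵀ * D : Matrix P P ℝ).PosSemidef := by
    simpa [Matrix.conjTranspose_eq_transpose_of_trivial] using Matrix.posSemidef_conjTranspose_mul_self D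
  exact PosDef.posSemidef_add h (PosDef.one.smul hε)

omit [DecidableEq P] in
/-- `Φ_ε ≥ 0`. [folklore] -/
theorem regForm_nonneg (D : Matrix κ P ℝ) {ε : ℝ} (hε : 0 < ε) (q : κ → ℝ) : 0 ≤ regForm D ε q :=
  dotProduct_inv_mulVec_nonneg (posDef_mul_transpose_add D hε) q

omit [DecidableEq P] in
/-- **Monotonicity in the regulator**: `Φ_ε ≤ Φ_{ε'}` for `ε' ≤ ε`. [cite: FrohlichSpencerCMP1982, §2.5 (2.34)] -/
theorem regForm_anti (D : Matrix κ P ℝ) {ε ε' : ℝ} (hε' : 0 < ε') (hle : ε' ≤ ε) (q : κ → ℝ) :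
    regForm D ε q ≤ regForm D ε' q := by
  refine dotProduct_inv_mulVec_anti (posDef_mul_transpose_add D hε') (posDef_mul_transpose_add D (hε'.trans_le hle))
    (fun a => ?_) q
  simp only [Matrix.add_mulVec, Matrix.smul_mulVec, Matrix.one_mulVec, dotProduct_add, dotProduct_smul, smul_eq_mul]
  have : 0 ≤ a ⬝ᵥ a := by simpa [dotProduct] using Finset.sum_nonneg fun i _ => mul_self_nonneg (a i)
  nlinarith

/-- **Push-through identity**: `(DDᵀ + ε)⁻¹ D = D (DᵀD + ε)⁻¹`. [folklore] -/
theorem inv_mul_transpose_add_mul (D : Matrix κ P ℝ) {ε : ℝ} (hε : 0 < ε) :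
    (((D * Dᵀ : Matrix κ κ ℝ) + ε • (1 : Matrix κ κ ℝ))⁻¹ * D : Matrix κ P ℝ) =
      (D * ((Dᵀ * D : Matrix P P ℝ) + ε • (1 : Matrix P P ℝ))⁻¹ : Matrix κ P ℝ) := by
  have hB : IsUnit ((D * Dᵀ : Matrix κ κ ℝ) + ε • (1 : Matrix κ κ ℝ)).det :=
    (Matrix.isUnit_iff_isUnit_det _).1 (posDef_mul_transpose_add D hε).isUnit
  have hG : IsUnit ((Dᵀ * D : Matrix P P ℝ) + ε • (1 : Matrix P P ℝ)).det :=
    (Matrix.isUnit_iff_isUnit_det _).1 (posDef_transpose_mul_add D hε).isUnit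
  have hcomm : (D * ((Dᵀ * D : Matrix P P ℝ) + ε • (1 : Matrix P P ℝ)) : Matrix κ P ℝ) =
      (((D * Dᵀ : Matrix κ κ ℝ) + ε • (1 : Matrix κ κ ℝ)) * D : Matrix κ P ℝ) := by
    rw [Matrix.mul_add, Matrix.add_mul, ← Matrix.mul_assoc, Matrix.mul_smul, Matrix.mul_one, Matrix.smul_mul,
      Matrix.one_mul]
  calc (((D * Dᵀ : Matrix κ κ ℝ) + ε • (1 : Matrix κ κ ℝ))⁻¹ * D : Matrix κ P ℝ)
      = ((((D * Dᵀ : Matrix κ κ ℝ) + ε • (1 : Matrix κ κ ℝ))⁻¹ *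
          (D * ((Dᵀ * D : Matrix P P ℝ) + ε • (1 : Matrix P P ℝ)) : Matrix κ P ℝ) : Matrix κ P ℝ) *
          ((Dᵀ * D : Matrix P P ℝ) + ε • (1 : Matrix P P ℝ))⁻¹ : Matrix κ P ℝ) := by
        rw [Matrix.mul_assoc, Matrix.mul_nonsing_inv_cancel_right _ _ hG]
    _ = D * ((Dᵀ * D : Matrix P P ℝ) + ε • (1 : Matrix P P ℝ))⁻¹ := by
        rw [hcomm, Matrix.nonsing_inv_mul_cancel_left _ _ hB]

/-- **The form on a flux**: `Φ_ε(Dm) = ‖m‖² - ε⟨m, (DᵀD + ε)⁻¹ m⟩`. [folklore] -/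
theorem regForm_flux_eq (D : Matrix κ P ℝ) {ε : ℝ} (hε : 0 < ε) (m : P → ℝ) :
    regForm D ε (D *ᵥ m) = m ⬝ᵥ m - ε * (m ⬝ᵥ (((Dᵀ * D : Matrix P P ℝ) + ε • (1 : Matrix P P ℝ))⁻¹ *ᵥ m)) := by
  have hG : IsUnit ((Dᵀ * D : Matrix P P ℝ) + ε • (1 : Matrix P P ℝ)).det :=
    (Matrix.isUnit_iff_isUnit_det _).1 (posDef_transpose_mul_add D hε).isUnit
  set Gε := Dᵀ * D + ε • (1 : Matrix P P ℝ) with hGε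
  have hsplit : (Dᵀ * D : Matrix P P ℝ) = Gε - ε • (1 : Matrix P P ℝ) := by rw [hGε, add_sub_cancel_right]
  rw [regForm, Matrix.mulVec_mulVec, inv_mul_transpose_add_mul D hε, ← hGε, ← Matrix.mulVec_mulVec,
    GaussianCoord.mulVec_dotProduct_eq, Matrix.mulVec_mulVec, hsplit, Matrix.sub_mulVec, Matrix.mulVec_mulVec,
    Matrix.mul_nonsing_inv _ hG, Matrix.one_mulVec, Matrix.smul_mulVec, Matrix.one_mulVec, dotProduct_sub,
    dotProduct_smul, smul_eq_mul]

/-- Upper bound: `Φ_ε(Dm) ≤ ‖m‖²`. [folklore] -/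
theorem regForm_flux_le_dotProduct_self (D : Matrix κ P ℝ) {ε : ℝ} (hε : 0 < ε) (m : P → ℝ) :
    regForm D ε (D *ᵥ m) ≤ m ⬝ᵥ m := by
  rw [regForm_flux_eq D hε, sub_le_self_iff]
  exact mul_nonneg hε.le (dotProduct_inv_mulVec_nonneg (posDef_transpose_mul_add D hε) m)

/-- **The regularised bilinear form** `⟨x, (DDᵀ + ε)⁻¹ y⟩` (the phase of the dual model couples a
charge density to `(DDᵀ + ε)⁻¹ D S`). [cite: FrohlichSpencerCMP1982, §2.7 (2.52)–(2.54)] -/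
def regBil (D : Matrix κ P ℝ) (ε : ℝ) (x y : κ → ℝ) : ℝ :=
  x ⬝ᵥ (((D * Dᵀ : Matrix κ κ ℝ) + ε • (1 : Matrix κ κ ℝ))⁻¹ *ᵥ y)

omit [DecidableEq P] in
/-- `regBil D ε q q = regForm D ε q`. [folklore] -/
theorem regBil_self (D : Matrix κ P ℝ) (ε : ℝ) (q : κ → ℝ) : regBil D ε q q = regForm D ε q := rfl

omit [DecidableEq P] in
/-- **Polarisation**: `2⟨x, (DDᵀ+ε)⁻¹ y⟩ = Φ_ε(x+y) - Φ_ε(x) - Φ_ε(y)` (`ε > 0`). [folklore] -/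
theorem two_mul_regBil_eq (D : Matrix κ P ℝ) {ε : ℝ} (hε : 0 < ε) (x y : κ → ℝ) :
    2 * regBil D ε x y = regForm D ε (x + y) - regForm D ε x - regForm D ε y := by
  have hsymm : (((D * Dᵀ : Matrix κ κ ℝ) + ε • (1 : Matrix κ κ ℝ))⁻¹)ᵀ =
      ((D * Dᵀ : Matrix κ κ ℝ) + ε • (1 : Matrix κ κ ℝ))⁻¹ := by
    rw [Matrix.transpose_nonsing_inv, transpose_eq_of_posDef (posDef_mul_transpose_add D hε)]
  simp only [regBil, regForm, Matrix.mulVec_add, add_dotProduct, dotProduct_add]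
  rw [dotProduct_mulVec_comm_of_transpose_eq hsymm y x]
  ring

omit [DecidableEq P] in
/-- **Divergence off the fluxes**: if `Dᵀa₀ = 0` then `Φ_ε(q) ≥ ⟨a₀, q⟩²/(ε ‖a₀‖²)` — for a
charge density with `dq ≠ 0` take `a₀ = dᵀe_{cell}`; the regularised energy blows up as `ε → 0`
(FS82 (2.34): "the right side tends to 0 … otherwise", (2.43)–(2.44)).
[cite: FrohlichSpencerCMP1982, §2.5 (2.34), §2.6 (2.43)–(2.44)] -/
theorem regForm_ge_sq_div (D : Matrix κ P ℝ) {ε : ℝ} (hε : 0 < ε) (q a₀ : κ → ℝ) (ha₀ : Dᵀ *ᵥ a₀ = 0)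
    (hne : a₀ ⬝ᵥ a₀ ≠ 0) : (a₀ ⬝ᵥ q) ^ 2 / (ε * (a₀ ⬝ᵥ a₀)) ≤ regForm D ε q := by
  have hpos : 0 < a₀ ⬝ᵥ a₀ := lt_of_le_of_ne
    (by simpa [dotProduct] using Finset.sum_nonneg fun i _ => mul_self_nonneg (a₀ i)) (Ne.symm hne)
  set t : ℝ := (a₀ ⬝ᵥ q) / (ε * (a₀ ⬝ᵥ a₀)) with ht
  have h := two_mul_dotProduct_sub_le (posDef_mul_transpose_add D hε) q (t • a₀)
  rw [regForm]
  refine le_trans (le_of_eq ?_) h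
  rw [smul_dotProduct, Matrix.mulVec_smul, dotProduct_smul, Matrix.add_mulVec, dotProduct_add,
    ← Matrix.mulVec_mulVec, ha₀, Matrix.mulVec_zero, dotProduct_zero, zero_add, Matrix.smul_mulVec,
    Matrix.one_mulVec, dotProduct_smul, smul_dotProduct]
  simp only [smul_eq_mul]
  rw [ht]
  field_simp
  ring

omit [DecidableEq P] in
/-- **Uniform coercivity**: if `‖Dᵀq‖² ≤ L ‖q‖²` then `Φ_ε(q) ≥ ‖q‖²/(L + ε)` (test vector
`a = q/(L+ε)`); for `ε ≤ 1` this is the summable Gaussian domination of the charge-density weights.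
[folklore] -/
theorem regForm_ge_norm_sq_div (D : Matrix κ P ℝ) {ε L : ℝ} (hε : 0 < ε) (hL : 0 ≤ L) (q : κ → ℝ)
    (hq : (Dᵀ *ᵥ q) ⬝ᵥ (Dᵀ *ᵥ q) ≤ L * (q ⬝ᵥ q)) : (q ⬝ᵥ q) / (L + ε) ≤ regForm D ε q := by
  have hLε : 0 < L + ε := by linarith
  set t : ℝ := 1 / (L + ε) with ht
  have h := two_mul_dotProduct_sub_le (posDef_mul_transpose_add D hε) q (t • q)
  rw [regForm]
  refine le_trans ?_ h
  rw [smul_dotProduct, Matrix.mulVec_smul, dotProduct_smul, Matrix.add_mulVec, dotProduct_add,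
    ← Matrix.mulVec_mulVec, dotProduct_mulVec (t • q) D, ← Matrix.mulVec_transpose, Matrix.mulVec_smul,
    smul_dotProduct, Matrix.smul_mulVec, Matrix.one_mulVec, dotProduct_smul, smul_dotProduct]
  simp only [smul_eq_mul]
  have hqq : 0 ≤ q ⬝ᵥ q := by simpa [dotProduct] using Finset.sum_nonneg fun i _ => mul_self_nonneg (q i)
  set X := (Dᵀ *ᵥ q) ⬝ᵥ (Dᵀ *ᵥ q) with hX
  set Q := q ⬝ᵥ q with hQ
  have hb : X + ε * Q ≤ (L + ε) * Q := by nlinarith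
  -- with `t = 1/(L+ε)`: `Q t ≤ 2 t Q - t (t X + t ε Q)` since `t (X + ε Q) ≤ Q`
  have ht0 : 0 < t := by rw [ht]; positivity
  have htb : t * (X + ε * Q) ≤ Q := by
    rw [ht, one_div, inv_mul_le_iff₀ hLε]
    linarith
  have hdiv : Q / (L + ε) = t * Q := by rw [ht]; ring
  rw [hdiv]
  nlinarith [mul_le_mul_of_nonneg_left htb ht0.le, mul_nonneg ht0.le hqq]

/-! ### The `ε → 0` limit on fluxes, given `ker D = range T` -/

section Limit

variable (T : Matrix P ι ℝ) (D : Matrix κ P ℝ)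

/-- The hypotheses "`ker D = range T`": `D T = 0` and every `D`-closed field is `T`-exact (for the
Villain model: `VillainFluxReal.ker_fluxMapR_eq_range_dFreeR`). [folklore] -/
structure KerEqRange : Prop where
  /-- `D ∘ T = 0`. [folklore] -/
  mul_eq_zero : (D * T : Matrix κ ι ℝ) = 0
  /-- `ker D ⊆ range T`. [folklore] -/
  exact_of_closed : ∀ m : P → ℝ, D *ᵥ m = 0 → ∃ θ : ι → ℝ, T *ᵥ θ = m

variable {T D}

omit [Fintype κ] [DecidableEq κ] [DecidableEq P] in
/-- `D` kills the exact part. [folklore] -/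
theorem mulVec_exactPart_eq_zero (h : KerEqRange T D) (m : P → ℝ) : D *ᵥ exactPart T m = 0 := by
  rw [exactPart, Matrix.mulVec_mulVec, h.mul_eq_zero, Matrix.zero_mulVec]

omit [DecidableEq κ] [DecidableEq P] in
/-- `DᵀD` kills the exact part. [folklore] -/
theorem gramD_mulVec_exactPart (h : KerEqRange T D) (m : P → ℝ) : (Dᵀ * D : Matrix P P ℝ) *ᵥ exactPart T m = 0 := by
  rw [← Matrix.mulVec_mulVec, mulVec_exactPart_eq_zero h, Matrix.mulVec_zero]

omit [DecidableEq κ] in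
/-- `(DᵀD + ε)⁻¹` acts as `ε⁻¹` on the exact part. [folklore] -/
theorem inv_mulVec_exactPart (h : KerEqRange T D) {ε : ℝ} (hε : 0 < ε) (m : P → ℝ) :
    ((Dᵀ * D : Matrix P P ℝ) + ε • (1 : Matrix P P ℝ))⁻¹ *ᵥ exactPart T m = ε⁻¹ • exactPart T m := by
  have hG : IsUnit ((Dᵀ * D : Matrix P P ℝ) + ε • (1 : Matrix P P ℝ)).det :=
    (Matrix.isUnit_iff_isUnit_det _).1 (posDef_transpose_mul_add D hε).isUnit
  have h1 : ((Dᵀ * D : Matrix P P ℝ) + ε • (1 : Matrix P P ℝ)) *ᵥ (ε⁻¹ • exactPart T m) = exactPart T m := by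
    rw [Matrix.mulVec_smul, Matrix.add_mulVec, gramD_mulVec_exactPart h, zero_add, Matrix.smul_mulVec,
      Matrix.one_mulVec, smul_smul, inv_mul_cancel₀ hε.ne', one_smul]
  calc ((Dᵀ * D : Matrix P P ℝ) + ε • (1 : Matrix P P ℝ))⁻¹ *ᵥ exactPart T m
      = ((Dᵀ * D : Matrix P P ℝ) + ε • (1 : Matrix P P ℝ))⁻¹ *ᵥ (((Dᵀ * D : Matrix P P ℝ) + ε • (1 : Matrix P P ℝ)) *ᵥ (ε⁻¹ • exactPart T m)) := by
        rw [h1]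
    _ = ε⁻¹ • exactPart T m := by
        rw [Matrix.mulVec_mulVec, Matrix.nonsing_inv_mul _ hG, Matrix.one_mulVec]

omit [DecidableEq κ] [DecidableEq P] in
/-- **The orthogonal part is in the range of `DᵀD` restricted to `{Tᵀ· = 0}`**: there is `w₀` with
`Tᵀw₀ = 0` and `DᵀD w₀ = m_⊥` (injective endomorphisms of finite-dimensional spaces are onto).
[folklore] -/
theorem exists_gramD_mulVec_eq_perpPart (hM : (gram T).PosDef) (h : KerEqRange T D) (m : P → ℝ) :
    ∃ w₀ : P → ℝ, Tᵀ *ᵥ w₀ = 0 ∧ (Dᵀ * D : Matrix P P ℝ) *ᵥ w₀ = perpPart T m := by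
  -- the subspace `W = {v : Tᵀ v = 0}` and the restriction of `DᵀD` to it
  set W : Submodule ℝ (P → ℝ) := LinearMap.ker (Matrix.mulVecLin Tᵀ) with hW
  have hmapsTo : ∀ v ∈ W, (Dᵀ * D : Matrix P P ℝ) *ᵥ v ∈ W := by
    intro v hv
    rw [hW, LinearMap.mem_ker, Matrix.mulVecLin_apply, Matrix.mulVec_mulVec, ← Matrix.mul_assoc,
      ← Matrix.transpose_mul]
    rw [show (D * T : Matrix κ ι ℝ)ᵀ = 0 by rw [h.mul_eq_zero, Matrix.transpose_zero], Matrix.zero_mul,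
      Matrix.zero_mulVec]
  set f : W →ₗ[ℝ] W := (Matrix.mulVecLin (Dᵀ * D : Matrix P P ℝ)).restrict (p := W) (q := W) fun v hv => hmapsTo v hv with hf
  have hinj : Function.Injective f := by
    rw [← LinearMap.ker_eq_bot, Submodule.eq_bot_iff]
    intro v hv
    rw [LinearMap.mem_ker] at hv
    have hGv : (Dᵀ * D : Matrix P P ℝ) *ᵥ (v : P → ℝ) = 0 := congrArg Subtype.val hv
    -- `D v = 0`
    have hDv : D *ᵥ (v : P → ℝ) = 0 := by
      have h0 : (v : P → ℝ) ⬝ᵥ ((Dᵀ * D : Matrix P P ℝ) *ᵥ (v : P → ℝ)) = 0 := by rw [hGv, dotProduct_zero]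
      rw [← Matrix.mulVec_mulVec, ← GaussianCoord.mulVec_dotProduct_eq] at h0
      exact dotProduct_self_eq_zero.1 h0
    -- hence `v ∈ range T`, and `v ⊥ range T`
    obtain ⟨θ, hθ⟩ := h.exact_of_closed _ hDv
    have hTv : Tᵀ *ᵥ (v : P → ℝ) = 0 := (LinearMap.mem_ker).1 v.2
    have : (v : P → ℝ) ⬝ᵥ (v : P → ℝ) = 0 := by
      calc (v : P → ℝ) ⬝ᵥ (v : P → ℝ) = (T *ᵥ θ) ⬝ᵥ (v : P → ℝ) := by rw [hθ]
        _ = θ ⬝ᵥ (Tᵀ *ᵥ (v : P → ℝ)) := GaussianCoord.mulVec_dotProduct_eq _ _ _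
        _ = 0 := by rw [hTv, dotProduct_zero]
    exact Subtype.ext (dotProduct_self_eq_zero.1 this)
  have hsurj : Function.Surjective f := LinearMap.injective_iff_surjective.1 hinj
  have hp : perpPart T m ∈ W := by
    rw [hW, LinearMap.mem_ker, Matrix.mulVecLin_apply]
    exact GaussianCoord.transpose_mulVec_perpPart T hM m
  obtain ⟨w₀, hw₀⟩ := hsurj ⟨perpPart T m, hp⟩
  exact ⟨w₀, (LinearMap.mem_ker).1 w₀.2, congrArg Subtype.val hw₀⟩

omit [Fintype κ] [DecidableEq κ] [DecidableEq P] in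
/-- The exact and orthogonal parts are orthogonal. [folklore] -/
theorem exactPart_dotProduct_perpPart (hM : (gram T).PosDef) (m : P → ℝ) :
    exactPart T m ⬝ᵥ perpPart T m = 0 := by
  rw [exactPart, GaussianCoord.mulVec_dotProduct_eq, GaussianCoord.transpose_mulVec_perpPart T hM, dotProduct_zero]

/-- **Two-sided bound on the form on a flux**: with `m_⊥ = perpPart T m` and `w₀` as in
`exists_gramD_mulVec_eq_perpPart`, for every `ε > 0`,
`‖m_⊥‖² - ε ⟨w₀, DᵀD w₀⟩ ≤ Φ_ε(Dm) ≤ ‖m_⊥‖²` — so `Φ_ε(Dm) → ‖m_⊥‖²` (FS82 (2.34)–(2.35): the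
regularised covariance tends to `(μ, V_Λ μ)` on the closed densities).
[cite: FrohlichSpencerCMP1982, §2.5 (2.34)–(2.35)] -/
theorem regForm_flux_bounds (hM : (gram T).PosDef) (h : KerEqRange T D) (m w₀ : P → ℝ)
    (hGw₀ : (Dᵀ * D : Matrix P P ℝ) *ᵥ w₀ = perpPart T m) {ε : ℝ} (hε : 0 < ε) :
    perpPart T m ⬝ᵥ perpPart T m - ε * (w₀ ⬝ᵥ ((Dᵀ * D : Matrix P P ℝ) *ᵥ w₀)) ≤ regForm D ε (D *ᵥ m) ∧
      regForm D ε (D *ᵥ m) ≤ perpPart T m ⬝ᵥ perpPart T m := by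
  have hG : IsUnit ((Dᵀ * D : Matrix P P ℝ) + ε • (1 : Matrix P P ℝ)).det :=
    (Matrix.isUnit_iff_isUnit_det _).1 (posDef_transpose_mul_add D hε).isUnit
  have hGpd := posDef_transpose_mul_add D hε
  have hGsymm := transpose_eq_of_posDef hGpd
  set Gε := Dᵀ * D + ε • (1 : Matrix P P ℝ) with hGε
  set u := exactPart T m with hu
  set p := perpPart T m with hp
  have hm : m = u + p := by rw [hp, perpPart, hu]; abel
  have hup : u ⬝ᵥ p = 0 := exactPart_dotProduct_perpPart hM m
  -- `ε ⟨m, Gε⁻¹ m⟩ = ‖u‖² + ε ⟨p, Gε⁻¹ p⟩`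
  have hinvu : Gε⁻¹ *ᵥ u = ε⁻¹ • u := inv_mulVec_exactPart h hε m
  have hcross : u ⬝ᵥ (Gε⁻¹ *ᵥ p) = 0 := by
    have hsymm_inv : (Gε⁻¹)ᵀ = Gε⁻¹ := by rw [Matrix.transpose_nonsing_inv, hGsymm]
    rw [dotProduct_mulVec_comm_of_transpose_eq hsymm_inv, hinvu, dotProduct_smul, dotProduct_comm, hup, smul_zero]
  have hdecomp : ε * (m ⬝ᵥ (Gε⁻¹ *ᵥ m)) = u ⬝ᵥ u + ε * (p ⬝ᵥ (Gε⁻¹ *ᵥ p)) := by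
    rw [hm, Matrix.mulVec_add, add_dotProduct, dotProduct_add, dotProduct_add, hinvu, dotProduct_smul,
      smul_eq_mul, hcross]
    have : p ⬝ᵥ (ε⁻¹ • u) = 0 := by rw [dotProduct_smul, dotProduct_comm, hup, smul_zero]
    rw [this]
    field_simp
    ring
  -- `Φ_ε(Dm) = ‖p‖² - ε ⟨p, Gε⁻¹ p⟩`
  have hnorm : m ⬝ᵥ m = u ⬝ᵥ u + p ⬝ᵥ p := by
    rw [hm, add_dotProduct, dotProduct_add, dotProduct_add, hup, dotProduct_comm p u, hup]; ring
  have hΦ : regForm D ε (D *ᵥ m) = p ⬝ᵥ p - ε * (p ⬝ᵥ (Gε⁻¹ *ᵥ p)) := by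
    rw [regForm_flux_eq D hε, ← hGε, hnorm]
    linarith [hdecomp]
  -- `0 ≤ ε ⟨p, Gε⁻¹ p⟩ ≤ ε ⟨w₀, G w₀⟩`
  have hlow : 0 ≤ p ⬝ᵥ (Gε⁻¹ *ᵥ p) := dotProduct_inv_mulVec_nonneg hGpd p
  have hGpsd : (Dᵀ * D : Matrix P P ℝ).PosSemidef := by
    simpa [Matrix.conjTranspose_eq_transpose_of_trivial] using Matrix.posSemidef_conjTranspose_mul_self D
  have hhigh : ε * (p ⬝ᵥ (Gε⁻¹ *ᵥ p)) ≤ ε * (w₀ ⬝ᵥ ((Dᵀ * D : Matrix P P ℝ) *ᵥ w₀)) := by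
    refine mul_le_mul_of_nonneg_left ?_ hε.le
    -- `p = G w₀`, `G Gε⁻¹ G = G - ε + ε² Gε⁻¹`
    have hGsplit : (Dᵀ * D : Matrix P P ℝ) = Gε - ε • (1 : Matrix P P ℝ) := by rw [hGε, add_sub_cancel_right]
    have hGw : (Dᵀ * D : Matrix P P ℝ) *ᵥ w₀ = Gε *ᵥ w₀ - ε • w₀ := by
      rw [hGsplit, Matrix.sub_mulVec, Matrix.smul_mulVec, Matrix.one_mulVec]
    have hinvG : Gε⁻¹ *ᵥ ((Dᵀ * D : Matrix P P ℝ) *ᵥ w₀) = w₀ - ε • (Gε⁻¹ *ᵥ w₀) := by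
      rw [hGw, Matrix.mulVec_sub, Matrix.mulVec_smul, Matrix.mulVec_mulVec, Matrix.nonsing_inv_mul _ hG,
        Matrix.one_mulVec]
    have h2 : ((Dᵀ * D : Matrix P P ℝ) *ᵥ w₀) ⬝ᵥ (Gε⁻¹ *ᵥ w₀) = w₀ ⬝ᵥ w₀ - ε * (w₀ ⬝ᵥ (Gε⁻¹ *ᵥ w₀)) := by
      rw [hGw, sub_dotProduct, smul_dotProduct, smul_eq_mul, dotProduct_comm (Gε *ᵥ w₀),
        dotProduct_mulVec_comm_of_transpose_eq hGsymm, Matrix.mulVec_mulVec, Matrix.mul_nonsing_inv _ hG,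
        Matrix.one_mulVec]
    have h1 : p ⬝ᵥ (Gε⁻¹ *ᵥ p) =
        w₀ ⬝ᵥ ((Dᵀ * D : Matrix P P ℝ) *ᵥ w₀) - ε * (w₀ ⬝ᵥ w₀) + ε ^ 2 * (w₀ ⬝ᵥ (Gε⁻¹ *ᵥ w₀)) := by
      rw [← hGw₀, hinvG, dotProduct_sub, dotProduct_smul, smul_eq_mul,
        dotProduct_comm ((Dᵀ * D : Matrix P P ℝ) *ᵥ w₀) w₀, h2]
      ring
    have h3 := dotProduct_inv_mulVec_le_div hGpsd hε w₀
    rw [← hGε] at h3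
    have hεX : ε * (w₀ ⬝ᵥ (Gε⁻¹ *ᵥ w₀)) ≤ w₀ ⬝ᵥ w₀ := by
      rw [mul_comm]; exact (le_div_iff₀ hε).1 h3
    rw [h1]
    nlinarith
  exact ⟨by rw [hΦ]; linarith, by rw [hΦ]; linarith [mul_nonneg hε.le hlow]⟩

end Limit

end GaussianCoord

end Literature.Probability.LatticeModels
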